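import Summits.BirchSwinnertonDyer.BirchSwinnertonDyer.Theorems.ResidualThetaTransportAtTwoPlusDualLayerCyclic
import HarnessLib

/-!
# Invariant forms on the layers of a cofree rank-one dual pair: the θ-dictionary

Support file for RTT P6 `ResidualLambdaFormulaNegDiscAtTwo` (stmt-BirchSwinnertonDyer-23110), line `hplusdual`, stub `stub_iso`
(ISO = Kim 2007 Prop. 3.15 at `p = 2`, θ-plan, step «θ-EXTRACTION»; LEAD g13 2026-08-28 22:31Z decision (1)). First half:

* §1 the layers `S[q^J, φ^N = 1]` as subgroups, stable under `ℤ[φ]`;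
* §2 biadditive `φ`-invariant forms on a layer: slot transfer `B(s, Q(φ)t) = B(Q(φ^{N−1})s, t)` (the adjoint `γ ↦ γ^{−1}`);
* §3 the dual-pair dictionary: an additive `M`-valued function on the layer `S[p^J, ω_n]` is `j ∘ toDual x` for some `x ∈ X`
  (`exists_toDual_eq_on`), and `toDual x` kills the layer iff `e x ∈ I(n, J) = (ω_n) + (p^J)`
  (`e_mem_omegaIdeal_of_forall`, `toDual_apply_eq_zero_of_e_mem`);
* §4 SEMILINEARITY of the encoding `t ↦ e(x_t)` of `B(·, t)` modulo `I(n, J)` (`e_sub_mul_e_mem_of_expansion`) and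
  «vanishing at a generator kills the form» (`form_eq_zero_of_e_mem`).

The extraction theorem itself is `forall_layerForm_eq_zero(_two)` in `…PlusDualThetaExtraction`.

References: B.D. Kim, *The parity conjecture for elliptic curves at supersingular reduction primes*, Compos. Math. 143 (2007),
Props. 3.14–3.18; R. Greenberg, LNM 1716 (1999), §1, §4; L. Washington, *Introduction to Cyclotomic Fields*, §13.2.
-/

set_option autoImplicit false
-- D-0017: single-problem summit, so `Summit.BirchSwinnertonDyer.BirchSwinnertonDyer.…` repeats a namespace BY DESIGN.
set_option linter.dupNamespace false

noncomputable section

open scoped Classical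
open Polynomial Finset Literature.NumberTheory.EllipticCurves Literature.NumberTheory.EllipticCurves.IwasawaDual

namespace Summit.BirchSwinnertonDyer.BirchSwinnertonDyer.Theorems.ResidualThetaLayer.PlusDual

/-! ## §1 Layers as subgroups; stability under `ℤ[φ]` -/

section Layer

variable {S : Type*} [AddCommGroup S] {φ : AddMonoid.End S}

omit φ in
/-- The layer `{s | q^J s = 0, φ^N s = s}` is a subgroup (stated as an existence to avoid a definition). [folklore] -/
theorem exists_layerSubgroup (φ : AddMonoid.End S) (q N J : ℕ) :
    ∃ A : AddSubgroup S, ∀ s, s ∈ A ↔ q ^ J • s = 0 ∧ (φ ^ N) s = s := by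
  refine ⟨(DistribSMul.toAddMonoidHom S (q ^ J)).ker ⊓ ((φ ^ N - 1 : AddMonoid.End S) : S →+ S).ker, fun s ↦ ?_⟩
  rw [AddSubgroup.mem_inf, AddMonoidHom.mem_ker, AddMonoidHom.mem_ker]
  show q ^ J • s = 0 ∧ (φ ^ N) s - s = 0 ↔ _
  rw [sub_eq_zero]

variable {A : AddSubgroup S}

/-- A `φ`-stable subgroup is stable under the powers of `φ`. [folklore] -/
theorem pow_apply_mem_of_phi_mem (hφA : ∀ s ∈ A, φ s ∈ A) (k : ℕ) {s : S} (hs : s ∈ A) : (φ ^ k) s ∈ A := by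
  induction k with
  | zero => rw [pow_zero]; exact hs
  | succ k ih => rw [pow_succ', AddMonoid.End.coe_mul, Function.comp_apply]; exact hφA _ ih

/-- A `φ`-stable subgroup is stable under `ℤ[φ]`. [folklore] -/
theorem aeval_apply_mem_of_phi_mem (hφA : ∀ s ∈ A, φ s ∈ A) (Q : ℤ[X]) {s : S} (hs : s ∈ A) : aeval φ Q s ∈ A := by
  induction Q using Polynomial.induction_on' with
  | add P R hP hR => rw [map_add]; exact A.add_mem hP hR
  | monomial k a =>
    rw [aeval_monomial, AddMonoid.End.coe_mul, Function.comp_apply, algebraMap_int_eq, eq_intCast,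
      AddMonoid.End.intCast_apply]
    exact A.zsmul_mem (pow_apply_mem_of_phi_mem hφA k hs) a

omit A in
/-- `Q(φ^k) = (Q ∘ Y^k)(φ)`. [folklore] -/
theorem aeval_pow_eq_aeval_comp (φ : AddMonoid.End S) (k : ℕ) (Q : ℤ[X]) : aeval (φ ^ k) Q = aeval φ (Q.comp (X ^ k)) := by
  rw [aeval_comp, map_pow, aeval_X]

/-- A `φ`-stable subgroup is stable under `ℤ[φ^k]`. [folklore] -/
theorem aeval_pow_apply_mem_of_phi_mem (hφA : ∀ s ∈ A, φ s ∈ A) (k : ℕ) (Q : ℤ[X]) {s : S} (hs : s ∈ A) :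
    aeval (φ ^ k) Q s ∈ A := by
  rw [aeval_pow_eq_aeval_comp]; exact aeval_apply_mem_of_phi_mem hφA _ hs

/-- `φ^{N i} s = s` when `φ^N s = s`. [folklore] -/
theorem pow_mul_apply_eq_self {N : ℕ} {s : S} (hfix : (φ ^ N) s = s) (i : ℕ) : (φ ^ (N * i)) s = s := by
  rw [pow_mul]
  induction i with
  | zero => rw [pow_zero]; rfl
  | succ i ih => rw [pow_succ, AddMonoid.End.coe_mul, Function.comp_apply, hfix, ih]

variable {q N J : ℕ}

/-- The layer `S[q^J, φ^N = 1]` is `φ`-stable. [folklore] -/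
theorem phi_mem_of_layer (hA : ∀ s, s ∈ A ↔ q ^ J • s = 0 ∧ (φ ^ N) s = s) {s : S} (hs : s ∈ A) : φ s ∈ A := by
  rw [hA] at hs ⊢
  refine ⟨by rw [← map_nsmul, hs.1, map_zero], ?_⟩
  show (φ ^ N * φ) s = φ s
  rw [← pow_succ, pow_succ', AddMonoid.End.coe_mul, Function.comp_apply, hs.2]

omit φ in
/-- **`ω̃⁻_n(y) = (∏_{1≤k≤(n+1)/2} Φ_{p^{(2k−2)+1}})(y + 1)`** in ANY `ℤ`-algebra (e.g. `End(S)`, non-commutative):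
`ω̃⁻_n = (∏ Φ_{p^{2k−1}}) ∘ (T + 1)` as polynomials. [cite: Pollack2003, §6.5 (display before Prop. 6.18)] -/
theorem aeval_cyclotomicOmegaMinus_eq_aeval_add_one' {A : Type*} [Ring A] [Algebra ℤ A] (p n : ℕ) (y : A) :
    aeval y (cyclotomicOmegaMinus p n) = aeval (y + 1) (∏ k ∈ Icc 1 ((n + 1) / 2), cyclotomic (p ^ (2 * k - 2 + 1)) ℤ) := by
  have h1 : cyclotomicOmegaMinus p n = (∏ k ∈ Icc 1 ((n + 1) / 2), cyclotomic (p ^ (2 * k - 2 + 1)) ℤ).comp (X + 1) := by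
    rw [cyclotomicOmegaMinus, Polynomial.prod_comp]
    refine Finset.prod_congr rfl fun k hk ↦ ?_
    rw [show 2 * k - 2 + 1 = 2 * k - 1 by have := (Finset.mem_Icc.mp hk).1; omega]
  rw [h1, aeval_comp, map_add, aeval_X, map_one]

end Layer

/-! ## §2 Invariant forms on a layer: moving `ℤ[φ]` across the form (adjoint `φ ↦ φ^{N−1}`) -/

section Form

variable {S : Type*} [AddCommGroup S] {φ : AddMonoid.End S} {A : AddSubgroup S}
variable {M : Type*} [AddCommGroup M]

omit [AddCommGroup M] in
/-- `B(φ^k s, φ^k t) = B(s, t)` for a `φ`-invariant form on a `φ`-stable subgroup. [cite: BDKim2007, Prop. 3.15 (proof)] -/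
theorem form_pow_pow (hφA : ∀ s ∈ A, φ s ∈ A) (B : S → S → M) (hinv : ∀ s ∈ A, ∀ t ∈ A, B (φ s) (φ t) = B s t)
    (k : ℕ) {s t : S} (hs : s ∈ A) (ht : t ∈ A) : B ((φ ^ k) s) ((φ ^ k) t) = B s t := by
  induction k with
  | zero => rw [pow_zero]; rfl
  | succ k ih =>
    rw [pow_succ', AddMonoid.End.coe_mul, Function.comp_apply, Function.comp_apply,
      hinv _ (pow_apply_mem_of_phi_mem hφA k hs) _ (pow_apply_mem_of_phi_mem hφA k ht), ih]

omit [AddCommGroup M] in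
/-- **Slot transfer**: `B(s, φ^i t) = B(φ^{i(N−1)} s, t)` on `S[·, φ^N = 1]` (`φ^{N−1} = φ^{−1}` there; the adjoint of `γ` is `γ^{−1}`).
[cite: BDKim2007, Prop. 3.15 (proof)] -/
theorem form_apply_pow (hφA : ∀ s ∈ A, φ s ∈ A) (B : S → S → M) (hinv : ∀ s ∈ A, ∀ t ∈ A, B (φ s) (φ t) = B s t)
    {N : ℕ} (hN : 0 < N) (hfix : ∀ s ∈ A, (φ ^ N) s = s) (i : ℕ) {s t : S} (hs : s ∈ A) (ht : t ∈ A) :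
    B s ((φ ^ i) t) = B ((φ ^ (i * (N - 1))) s) t := by
  have h1 := form_pow_pow hφA B hinv i (pow_apply_mem_of_phi_mem hφA (i * (N - 1)) hs) ht
  rw [← h1, ← Function.comp_apply (f := ⇑(φ ^ i)) (g := ⇑(φ ^ (i * (N - 1)))) (x := s), ← AddMonoid.End.coe_mul, ← pow_add]
  obtain ⟨N', rfl⟩ := Nat.exists_eq_succ_of_ne_zero hN.ne'
  rw [Nat.succ_sub_one, show i + i * N' = (N' + 1) * i by ring, pow_mul_apply_eq_self (hfix s hs)]

/-- `B(s, a•t) = a•B(s, t)`, `a ∈ ℤ`, for a form additive in the second slot on `A`. [folklore] -/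
theorem form_zsmul_right (B : S → S → M) (hadd₂ : ∀ s ∈ A, ∀ t₁ ∈ A, ∀ t₂ ∈ A, B s (t₁ + t₂) = B s t₁ + B s t₂)
    {s t : S} (hs : s ∈ A) (ht : t ∈ A) (a : ℤ) : B s (a • t) = a • B s t := by
  let f : A →+ M := AddMonoidHom.mk' (fun u ↦ B s u) fun u v ↦ hadd₂ s hs u u.2 v v.2
  have h1 : B s (a • t) = f (a • ⟨t, ht⟩) := rfl
  rw [h1, map_zsmul]; rfl

/-- `B(a•s, t) = a•B(s, t)`, `a ∈ ℤ`, for a form additive in the first slot on `A`. [folklore] -/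
theorem form_zsmul_left (B : S → S → M) (hadd₁ : ∀ s₁ ∈ A, ∀ s₂ ∈ A, ∀ t ∈ A, B (s₁ + s₂) t = B s₁ t + B s₂ t)
    {s t : S} (hs : s ∈ A) (ht : t ∈ A) (a : ℤ) : B (a • s) t = a • B s t := by
  let f : A →+ M := AddMonoidHom.mk' (fun u ↦ B u t) fun u v ↦ hadd₁ u u.2 v v.2 t ht
  have h1 : B (a • s) t = f (a • ⟨s, hs⟩) := rfl
  rw [h1, map_zsmul]; rfl

/-- `B(s, ∑ cᵢ•yᵢ) = ∑ cᵢ•B(s, yᵢ)` (`cᵢ ∈ ℕ`, `yᵢ ∈ A`). [folklore] -/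
theorem form_sum_nsmul_right (B : S → S → M) (hadd₂ : ∀ s ∈ A, ∀ t₁ ∈ A, ∀ t₂ ∈ A, B s (t₁ + t₂) = B s t₁ + B s t₂)
    {s : S} (hs : s ∈ A) {ι : Type*} (T : Finset ι) (c : ι → ℕ) (y : ι → S) (hy : ∀ i, y i ∈ A) :
    B s (∑ i ∈ T, c i • y i) = ∑ i ∈ T, c i • B s (y i) := by
  let f : A →+ M := AddMonoidHom.mk' (fun u ↦ B s u) fun u v ↦ hadd₂ s hs u u.2 v v.2
  have h1 : (∑ i ∈ T, c i • y i) = ((∑ i ∈ T, c i • (⟨y i, hy i⟩ : A) : A) : S) := by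
    rw [AddSubgroup.val_finsetSum]
    exact Finset.sum_congr rfl fun i _ ↦ (AddSubmonoidClass.coe_nsmul (⟨y i, hy i⟩ : A) (c i)).symm
  have h2 : B s (∑ i ∈ T, c i • y i) = f (∑ i ∈ T, c i • ⟨y i, hy i⟩) := by rw [h1]; rfl
  rw [h2, map_sum]
  exact Finset.sum_congr rfl fun i _ ↦ by rw [map_nsmul]; rfl

/-- **Slot transfer for polynomials**: `B(s, Q(φ) t) = B(Q(φ^{N−1}) s, t)` on `S[·, φ^N = 1]` for a biadditive `φ`-invariant form.
[cite: BDKim2007, Prop. 3.15 (proof)] -/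
theorem form_apply_aeval (hφA : ∀ s ∈ A, φ s ∈ A) (B : S → S → M)
    (hadd₁ : ∀ s₁ ∈ A, ∀ s₂ ∈ A, ∀ t ∈ A, B (s₁ + s₂) t = B s₁ t + B s₂ t)
    (hadd₂ : ∀ s ∈ A, ∀ t₁ ∈ A, ∀ t₂ ∈ A, B s (t₁ + t₂) = B s t₁ + B s t₂)
    (hinv : ∀ s ∈ A, ∀ t ∈ A, B (φ s) (φ t) = B s t)
    {N : ℕ} (hN : 0 < N) (hfix : ∀ s ∈ A, (φ ^ N) s = s) (Q : ℤ[X]) {s t : S} (hs : s ∈ A) (ht : t ∈ A) :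
    B s (aeval φ Q t) = B (aeval (φ ^ (N - 1)) Q s) t := by
  induction Q using Polynomial.induction_on' with
  | add P R hP hR =>
    rw [map_add, map_add]
    show B s (aeval φ P t + aeval φ R t) = B (aeval (φ ^ (N - 1)) P s + aeval (φ ^ (N - 1)) R s) t
    rw [hadd₂ s hs _ (aeval_apply_mem_of_phi_mem hφA P ht) _ (aeval_apply_mem_of_phi_mem hφA R ht),
      hadd₁ _ (aeval_pow_apply_mem_of_phi_mem hφA _ P hs) _ (aeval_pow_apply_mem_of_phi_mem hφA _ R hs) t ht, hP, hR]
  | monomial k a =>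
    rw [aeval_monomial, aeval_monomial, AddMonoid.End.coe_mul, AddMonoid.End.coe_mul, Function.comp_apply,
      Function.comp_apply, algebraMap_int_eq, eq_intCast, AddMonoid.End.intCast_apply, AddMonoid.End.intCast_apply,
      ← pow_mul, form_zsmul_right B hadd₂ hs (pow_apply_mem_of_phi_mem hφA k ht),
      form_apply_pow hφA B hinv hN hfix k hs ht, form_zsmul_left B hadd₁ (pow_apply_mem_of_phi_mem hφA _ hs) ht, mul_comm k]

end Form

/-! ## §3 From characters on a layer to `Λ`: the dual-pair dictionary -/

section Dictionary

variable {p : ℕ} [hp : Fact p.Prime]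
variable {S : Type*} [AddCommGroup S] {φ : AddMonoid.End S}
variable {Xd : Type*} [AddCommGroup Xd] [Module (PowerSeries ℤ_[p]) Xd] {toDual : Xd →+ (S →+ AddCircle (1 : ℚ))}
variable {M : Type*} [AddCommGroup M]

/-- **Every additive `M`-valued function on a subgroup is `j ∘ (toDual x)|` for some `x ∈ X`** (`j : M → ℚ/ℤ`; extend the
character `j ∘ f` from `A` to `S` by the injectivity of `ℚ/ℤ`, then invert `toDual`). [cite: GreenbergLNM1716, §1 p. 60]
[cite: Tate1966Bourbaki, §5 Lemma z.3] -/
theorem exists_toDual_eq_on (h : IsDualPair p (φ - 1) toDual) (A : AddSubgroup S) (j : M →+ AddCircle (1 : ℚ)) (f : S → M)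
    (hf : ∀ s₁ ∈ A, ∀ s₂ ∈ A, f (s₁ + s₂) = f s₁ + f s₂) : ∃ x : Xd, ∀ s ∈ A, toDual x s = j (f s) := by
  let F : A →+ AddCircle (1 : ℚ) := AddMonoidHom.mk' (fun a ↦ j (f a)) fun a b ↦ by
    show j (f ((a : S) + b)) = _
    rw [hf _ a.2 _ b.2, map_add]
  obtain ⟨χ, hχ⟩ := CharacterModule.dual_surjective_of_injective (R := ℤ) A.subtype.toIntLinearMap
    (fun a b hab ↦ Subtype.ext hab) F
  obtain ⟨x, hx⟩ := h.bijective.2 χ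
  refine ⟨x, fun s hs ↦ ?_⟩
  have h1 := DFunLike.congr_fun hχ ⟨s, hs⟩
  rw [CharacterModule.dual_apply] at h1
  rw [hx]
  exact h1

/-- **A `Λ`-lift that kills the layer `S[p^J, ω_n]` lies in `I(n, J) = (ω_n) + (p^J)`** (after `e : X ≃ₗ Λ`): the two transposed
pairs `(p^J, p^J•)` and `(ω_n, φ^{pⁿ} − 1)` and `mem_ideal_span_smul_top_of_forall_iInf_ker`. Kim: «`H_n[p^j] = Hom(Λ/(ω_n, p^j), ℚ_p/ℤ_p)`».
[cite: BDKim2007, Prop. 3.15 (proof)] [cite: GreenbergLNM1716, §4 p. 98] -/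
theorem e_mem_omegaIdeal_of_forall (h : IsDualPair p (φ - 1) toDual) (e : Xd ≃ₗ[PowerSeries ℤ_[p]] PowerSeries ℤ_[p])
    {n J : ℕ} {A : AddSubgroup S} (hA : ∀ s, s ∈ A ↔ p ^ J • s = 0 ∧ (φ ^ p ^ n) s = s) {x : Xd}
    (hx : ∀ s ∈ A, toDual x s = 0) :
    e x ∈ Ideal.span {(((X + 1 : ℤ_[p][X]) ^ p ^ n - 1 : ℤ_[p][X]) : PowerSeries ℤ_[p])} ⊔
      Ideal.span {PowerSeries.C ((p : ℤ_[p]) ^ J)} := by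
  let qv : Fin 2 → PowerSeries ℤ_[p] :=
    ![PowerSeries.C ((p : ℤ_[p]) ^ J), (((X + 1 : ℤ_[p][X]) ^ p ^ n - 1 : ℤ_[p][X]) : PowerSeries ℤ_[p])]
  let Ψv : Fin 2 → (S →+ S) := ![DistribSMul.toAddMonoidHom S (p ^ J), ((φ ^ p ^ n - 1 : AddMonoid.End S) : S →+ S)]
  have hqv : ∀ (i : Fin 2) (y : Xd) (s : S), toDual (qv i • y) s = toDual y (Ψv i s) := by
    intro i y s
    fin_cases i
    · show toDual (PowerSeries.C ((p : ℤ_[p]) ^ J) • y) s = toDual y (p ^ J • s)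
      rw [show PowerSeries.C ((p : ℤ_[p]) ^ J) = ((p ^ J : ℕ) : PowerSeries ℤ_[p]) by rw [Nat.cast_pow, map_pow, map_natCast],
        Nat.cast_smul_eq_nsmul, nsmul_eval]
    · exact transpose_omega h n y s
  have hmem := mem_ideal_span_smul_top_of_forall_iInf_ker toDual h.bijective qv Ψv hqv (x := x) fun s hs ↦ hx s (by
    rw [hA]
    have h0 := hs 0
    have h1 := hs 1
    simp only [Ψv, Matrix.cons_val_zero, Matrix.cons_val_one] at h0 h1
    exact ⟨h0, sub_eq_zero.mp h1⟩)
  have hrange : Set.range qv =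
      {PowerSeries.C ((p : ℤ_[p]) ^ J), (((X + 1 : ℤ_[p][X]) ^ p ^ n - 1 : ℤ_[p][X]) : PowerSeries ℤ_[p])} := by
    simp only [qv, Matrix.range_cons, Matrix.range_empty, Set.union_empty, Set.singleton_union]
  have h2 : e x ∈ Submodule.map (e : Xd →ₗ[PowerSeries ℤ_[p]] PowerSeries ℤ_[p]) (Ideal.span (Set.range qv) • ⊤) :=
    Submodule.mem_map_of_mem hmem
  rw [Submodule.map_smul'', Submodule.map_top, LinearEquiv.range, hrange, Ideal.smul_eq_mul, Ideal.mul_top, Ideal.span_insert,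
    sup_comm] at h2
  exact h2

/-- **Conversely, a lift in `I(n, J)` kills the layer** (`ω_n` acts as `φ^{pⁿ} − 1`, `p^J` as `p^J`). [cite: BDKim2007, Prop. 3.15 (proof)] -/
theorem toDual_apply_eq_zero_of_e_mem (h : IsDualPair p (φ - 1) toDual) (e : Xd ≃ₗ[PowerSeries ℤ_[p]] PowerSeries ℤ_[p])
    {n J : ℕ} {A : AddSubgroup S} (hA : ∀ s, s ∈ A ↔ p ^ J • s = 0 ∧ (φ ^ p ^ n) s = s) {x : Xd}
    (hx : e x ∈ Ideal.span {(((X + 1 : ℤ_[p][X]) ^ p ^ n - 1 : ℤ_[p][X]) : PowerSeries ℤ_[p])} ⊔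
      Ideal.span {PowerSeries.C ((p : ℤ_[p]) ^ J)}) {s : S} (hs : s ∈ A) : toDual x s = 0 := by
  obtain ⟨u, v, huv⟩ := mem_span_sup_span_iff.mp hx
  have hx' : x = ((((X + 1 : ℤ_[p][X]) ^ p ^ n - 1 : ℤ_[p][X]) : PowerSeries ℤ_[p]) * u) • e.symm 1 +
      (PowerSeries.C ((p : ℤ_[p]) ^ J) * v) • e.symm 1 := by
    apply e.injective
    rw [map_add, map_smul, map_smul, smul_eq_mul, smul_eq_mul, e.apply_symm_apply, mul_one, mul_one, huv]
  obtain ⟨hs1, hs2⟩ := (hA s).mp hs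
  rw [hx', map_add, AddMonoidHom.add_apply, mul_smul, mul_smul, transpose_omega h n,
    show PowerSeries.C ((p : ℤ_[p]) ^ J) = ((p ^ J : ℕ) : PowerSeries ℤ_[p]) by rw [Nat.cast_pow, map_pow, map_natCast],
    Nat.cast_smul_eq_nsmul, nsmul_eval, hs1, map_zero, add_zero]
  show toDual (u • e.symm 1) ((φ ^ p ^ n) s - s) = 0
  rw [hs2, sub_self, map_zero]

/-- Transpose of `Q((1+T)^k)`: it acts through `toDual` as `Q(φ^k)`. [cite: GreenbergLNM1716, §1 p. 60 (`T = γ − 1`)] -/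
theorem toDual_aeval_pow_smul (h : IsDualPair p (φ - 1) toDual) (k : ℕ) (Q : ℤ[X]) (x : Xd) (s : S) :
    toDual ((aeval ((1 + PowerSeries.X : PowerSeries ℤ_[p]) ^ k) Q) • x) s = toDual x (aeval (φ ^ k) Q s) := by
  have h1 : aeval ((1 + PowerSeries.X : PowerSeries ℤ_[p]) ^ k) Q = aeval (1 + PowerSeries.X : PowerSeries ℤ_[p]) (Q.comp (X ^ k)) := by
    rw [aeval_comp, map_pow, aeval_X]
  rw [h1, aeval_pow_eq_aeval_comp, toDual_aeval_one_add_X_smul h]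


/-- `Q(φ)` commutes with the powers of `φ`. [folklore] -/
theorem aeval_apply_pow_apply (φ : AddMonoid.End S) (Q : ℤ[X]) (i : ℕ) (s : S) :
    aeval φ Q ((φ ^ i) s) = (φ ^ i) (aeval φ Q s) := by
  show (aeval φ Q * φ ^ i) s = (φ ^ i * aeval φ Q) s
  rw [show φ ^ i = aeval φ (X ^ i : ℤ[X]) by rw [map_pow, aeval_X], ← map_mul, ← map_mul, mul_comm]

end Dictionary

/-! ## §4 The θ-dictionary: semilinearity, vanishing, norm compatibility -/

section Theta

variable {p : ℕ} [hp : Fact p.Prime]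
variable {S : Type*} [AddCommGroup S] {φ : AddMonoid.End S}
variable {Xd : Type*} [AddCommGroup Xd] [Module (PowerSeries ℤ_[p]) Xd] {toDual : Xd →+ (S →+ AddCircle (1 : ℚ))}
variable {M : Type*} [AddCommGroup M]

/-- **SEMILINEARITY of the θ-encoding.** On the layer `A = S[p^J, ω_n]` let `x_b, x_t ∈ X` encode `B(·, b)` and `B(·, t)`
(`toDual x_b = j∘B(·,b)` on `A`) for a `φ`-invariant form `B`, where `t = ∑ cᵢ φⁱ b`. Then
`e(x_t) ≡ (∑ cᵢ (1+T)^{i(pⁿ−1)})·e(x_b)` modulo `I(n, J)`: the second slot is `ℤ[φ]`-semilinear for the adjoint `γ ↦ γ^{−1}`.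
[cite: BDKim2007, Prop. 3.15 (proof)] [cite: GreenbergLNM1716, §1 p. 60] -/
theorem e_sub_mul_e_mem_of_expansion (h : IsDualPair p (φ - 1) toDual) (e : Xd ≃ₗ[PowerSeries ℤ_[p]] PowerSeries ℤ_[p])
    {n J : ℕ} {A : AddSubgroup S} (hA : ∀ s, s ∈ A ↔ p ^ J • s = 0 ∧ (φ ^ p ^ n) s = s)
    (j : M →+ AddCircle (1 : ℚ)) (B : S → S → M)
    (hadd₂ : ∀ s ∈ A, ∀ t₁ ∈ A, ∀ t₂ ∈ A, B s (t₁ + t₂) = B s t₁ + B s t₂)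
    (hinv : ∀ s ∈ A, ∀ t ∈ A, B (φ s) (φ t) = B s t)
    {b : S} (hb : b ∈ A) {R : ℕ} (c : Fin R → ℕ) {xb xt : Xd}
    (hxb : ∀ s ∈ A, toDual xb s = j (B s b)) (hxt : ∀ s ∈ A, toDual xt s = j (B s (∑ i, c i • (φ ^ (i : ℕ)) b))) :
    e xt - (∑ i, ((c i : ℕ) : PowerSeries ℤ_[p]) * (1 + PowerSeries.X : PowerSeries ℤ_[p]) ^ ((i : ℕ) * (p ^ n - 1))) * e xb ∈
      Ideal.span {(((X + 1 : ℤ_[p][X]) ^ p ^ n - 1 : ℤ_[p][X]) : PowerSeries ℤ_[p])} ⊔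
        Ideal.span {PowerSeries.C ((p : ℤ_[p]) ^ J)} := by
  have hφA : ∀ s ∈ A, φ s ∈ A := fun s hs ↦ phi_mem_of_layer hA hs
  have hfix : ∀ s ∈ A, (φ ^ p ^ n) s = s := fun s hs ↦ ((hA s).mp hs).2
  have hN : 0 < p ^ n := pow_pos hp.out.pos n
  have h1 : e (xt - (∑ i, ((c i : ℕ) : PowerSeries ℤ_[p]) * (1 + PowerSeries.X : PowerSeries ℤ_[p]) ^ ((i : ℕ) * (p ^ n - 1))) • xb) ∈
      Ideal.span {(((X + 1 : ℤ_[p][X]) ^ p ^ n - 1 : ℤ_[p][X]) : PowerSeries ℤ_[p])} ⊔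
        Ideal.span {PowerSeries.C ((p : ℤ_[p]) ^ J)} := by
    refine e_mem_omegaIdeal_of_forall h e hA fun s hs ↦ ?_
    rw [map_sub, AddMonoidHom.sub_apply, hxt s hs, Finset.sum_smul, map_sum, AddMonoidHom.finsetSum_apply,
      form_sum_nsmul_right B hadd₂ hs Finset.univ c (fun i ↦ (φ ^ (i : ℕ)) b) (fun i ↦ pow_apply_mem_of_phi_mem hφA _ hb),
      map_sum, sub_eq_zero]
    refine Finset.sum_congr rfl fun i _ ↦ ?_
    rw [map_nsmul, mul_smul, Nat.cast_smul_eq_nsmul, nsmul_eval, map_nsmul, h.toDual_one_add_X_pow_smul,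
      hxb _ (pow_apply_mem_of_phi_mem hφA _ hs), form_apply_pow hφA B hinv hN hfix i hs hb]
  rwa [map_sub, map_smul, smul_eq_mul] at h1

/-- **VANISHING AT A GENERATOR KILLS THE FORM.** If every `t` of the layer is `∑ cᵢ φⁱ g` and the θ-encoding `e(x_g)` of `B(·, g)`
lies in `I(n, J)`, then `B ≡ 0` on the layer (semilinearity puts every `e(x_t)` in `I(n,J)`, whose lifts kill the layer, and
`j : M ↪ ℚ/ℤ`). [cite: BDKim2007, Prop. 3.15 (proof)] -/
theorem form_eq_zero_of_e_mem (h : IsDualPair p (φ - 1) toDual) (e : Xd ≃ₗ[PowerSeries ℤ_[p]] PowerSeries ℤ_[p])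
    {n J : ℕ} {A : AddSubgroup S} (hA : ∀ s, s ∈ A ↔ p ^ J • s = 0 ∧ (φ ^ p ^ n) s = s)
    (j : M →+ AddCircle (1 : ℚ)) (hj : Function.Injective j) (B : S → S → M)
    (hadd₂ : ∀ s ∈ A, ∀ t₁ ∈ A, ∀ t₂ ∈ A, B s (t₁ + t₂) = B s t₁ + B s t₂)
    (hinv : ∀ s ∈ A, ∀ t ∈ A, B (φ s) (φ t) = B s t)
    {g : S} (hg : g ∈ A) (hgen : ∀ t ∈ A, ∃ c : Fin (p ^ n) → ℕ, t = ∑ i, c i • (φ ^ (i : ℕ)) g)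
    (x : S → Xd) (hx : ∀ t ∈ A, ∀ s ∈ A, toDual (x t) s = j (B s t))
    (hθ : e (x g) ∈ Ideal.span {(((X + 1 : ℤ_[p][X]) ^ p ^ n - 1 : ℤ_[p][X]) : PowerSeries ℤ_[p])} ⊔
      Ideal.span {PowerSeries.C ((p : ℤ_[p]) ^ J)})
    {s t : S} (hs : s ∈ A) (ht : t ∈ A) : B s t = 0 := by
  obtain ⟨c, hc⟩ := hgen t ht
  have h1 := e_sub_mul_e_mem_of_expansion h e hA j B hadd₂ hinv hg c (hx g hg) (xt := x t)
    (fun s' hs' ↦ by rw [← hc]; exact hx t ht s' hs')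
  have h2 : e (x t) ∈ Ideal.span {(((X + 1 : ℤ_[p][X]) ^ p ^ n - 1 : ℤ_[p][X]) : PowerSeries ℤ_[p])} ⊔
      Ideal.span {PowerSeries.C ((p : ℤ_[p]) ^ J)} := by
    have := add_mem h1 (Ideal.mul_mem_left _
      (∑ i, ((c i : ℕ) : PowerSeries ℤ_[p]) * (1 + PowerSeries.X : PowerSeries ℤ_[p]) ^ ((i : ℕ) * (p ^ n - 1))) hθ)
    rwa [sub_add_cancel] at this
  have h3 := toDual_apply_eq_zero_of_e_mem h e hA h2 hs
  rw [hx t ht s hs, ← map_zero j] at h3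
  exact hj h3

end Theta

end Summit.BirchSwinnertonDyer.BirchSwinnertonDyer.Theorems.ResidualThetaLayer.PlusDual

end
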